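import Summits.ResolutionOfSingularities.ResolutionOfSingularities.Theses.Valuative
import Literature.AlgebraicGeometry.Resolution.ProperModelsPatching
import Literature.AlgebraicGeometry.Resolution.ProperModelsPatchingGluing
import Literature.AlgebraicGeometry.Resolution.RegularLocalRingsProofs
import Mathlib.AlgebraicGeometry.Properties

/-!
# Negative-lane lemmas for crux `PatchingRel` (stmt-ResolutionOfSingularities-0642), line
# `sandwiched-gluing`, stub `stub_sandwichedStrongResolution`: slack in the integrality hypotheses
# of the atom SAND⁺

The line's residual atom is `Literature.AlgebraicGeometry.Resolution.SandwichedStrongResolution p`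
(strong resolution of an integral `V` proper and birational over a regular integral separated
`k`-scheme of finite type `U`, `char k = p`). Hypothesis mutation (drefute gen 3) — two of its
hypotheses are NOT load-bearing, so provers and re-typers may drop / weaken them freely:

* `sand_without_isIntegral_base` — `IsIntegral U` is REDUNDANT: a regular scheme is reduced
  (regular local rings are domains, `isDomain_of_isRegularLocalRing`) and the dense open over which
  the birational `η` is an isomorphism is homeomorphic to a non-empty open of the irreducible `V`,
  so `U` is irreducible (`isIntegral_base_of_isBirational`; preirreducibility helpers from
  `ProperModelsPatchingGluing.lean`).
* `sand_with_isReduced_source` — `IsIntegral V` may be WEAKENED to `IsReduced V`: the source of a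
  birational morphism to an irreducible scheme is irreducible and non-empty
  (`isIntegral_source_of_isBirational`).

The structural hypotheses (regularity of the roof `U`, birationality of `η`, the iso-over-`Reg`
clause) ARE load-bearing: `Cruxes/PatchingRel/Disproof.lean` §6 (T1)–(T3).
-/

open CategoryTheory AlgebraicGeometry
open Literature.AlgebraicGeometry.Resolution

set_option linter.dupNamespace false

namespace Summit.ResolutionOfSingularities.ResolutionOfSingularities.Theorems.PatchingRel.Negative

universe u

/-! ### Irreducibility bookkeeping (the preirreducibility helpers are `SandwichedGluing.*` of
`ProperModelsPatchingGluing.lean`) -/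

/-- **The base of a birational morphism from an integral scheme to a regular scheme is integral**
(`IsIntegral U` is implied by `Scheme.IsRegular U`, `IsIntegral V`, `IsBirational η`). [folklore] -/
theorem isIntegral_base_of_isBirational {U V : Scheme.{u}} (η : V ⟶ U)
    (hreg : Scheme.IsRegular U) [IsIntegral V] (hbir : IsBirational η) : IsIntegral U := by
  haveI : Nonempty U := ⟨η.base (Classical.arbitrary V)⟩
  -- reduced: regular local rings are domains
  haveI : ∀ x : U, _root_.IsReduced (U.presheaf.stalk x) := fun x => by
    haveI := hreg x
    haveI := isDomain_of_isRegularLocalRing (U.presheaf.stalk x)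
    infer_instance
  haveI : IsReduced U := isReduced_of_isReduced_stalk U
  -- irreducible: the dense open `U₀` is homeomorphic to the irreducible `η⁻¹ U₀`
  obtain ⟨U₀, hU₀, -, hiso⟩ := hbir
  haveI := hiso
  haveI : PreirreducibleSpace (η ⁻¹ᵁ U₀ : Scheme.{u}) := SandwichedGluing.preirreducibleSpace_opens _
  haveI : PreirreducibleSpace (U₀ : Scheme.{u}) :=
    SandwichedGluing.preirreducibleSpace_of_iso (asIso (η ∣_ U₀)).symm
  have h1 : IsPreirreducible ((U₀ : U.Opens) : Set U) := by
    rw [← Scheme.Opens.range_ι]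
    exact SandwichedGluing.isPreirreducible_range _
  have h2 := h1.closure
  rw [hU₀.closure_eq] at h2
  haveI : PreirreducibleSpace U := ⟨h2⟩
  haveI : IrreducibleSpace U := ⟨inferInstance⟩
  exact isIntegral_of_irreducibleSpace_of_isReduced U

/-- **The source of a birational morphism from a reduced scheme to an integral scheme is integral**
(`IsIntegral V` is implied by `IsIntegral U`, `IsReduced V`, `IsBirational η`). [folklore] -/
theorem isIntegral_source_of_isBirational {U V : Scheme.{u}} (η : V ⟶ U) [IsIntegral U]
    [IsReduced V] (hbir : IsBirational η) : IsIntegral V := by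
  haveI : PreirreducibleSpace V := SandwichedGluing.preirreducibleSpace_of_isBirational η hbir
  obtain ⟨U₀, hU₀, -, hiso⟩ := hbir
  haveI := hiso
  have hne : ((U₀ : U.Opens) : Set U).Nonempty := hU₀.nonempty
  haveI : Nonempty (U₀ : Scheme.{u}) := ⟨⟨hne.some, hne.some_mem⟩⟩
  haveI : Nonempty (η ⁻¹ᵁ U₀ : Scheme.{u}) := ⟨(inv (η ∣_ U₀)).base (Classical.arbitrary _)⟩
  haveI : Nonempty V := ⟨(η ⁻¹ᵁ U₀).ι.base (Classical.arbitrary _)⟩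
  haveI : IrreducibleSpace V := ⟨inferInstance⟩
  exact isIntegral_of_irreducibleSpace_of_isReduced V

/-! ### The two slack statements -/

/-- **`IsIntegral U` is redundant in SAND⁺**: `SandwichedStrongResolution p` implies its variant
with the hypothesis `IsIntegral U` deleted (the converse is trivial). [folklore] -/
theorem sand_without_isIntegral_base (p : ℕ) (h : SandwichedStrongResolution.{u} p) :
    ∀ (k : Type u) [Field k] [CharP k p] (U V : Scheme.{u}) (f : U ⟶ Spec (.of k)) (η : V ⟶ U),
      IsSeparated f → LocallyOfFiniteType f → QuasiCompact f →
      Scheme.IsRegular U → IsIntegral V → IsProper η → IsBirational η →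
        ∃ (Y : Scheme.{u}) (π : Y ⟶ V), IsResolution π ∧
          ∃ W : V.Opens, (W : Set V) = Scheme.regularLocus V ∧ IsIso (π ∣_ W) := by
  intro k _ _ U V f η hsep hft hqc hreg hV hη hbir
  haveI := hV
  exact h k U V f η hsep hft hqc (isIntegral_base_of_isBirational η hreg hbir) hreg hV hη hbir

/-- **`IsIntegral V` may be weakened to `IsReduced V` in SAND⁺**: `SandwichedStrongResolution p`
implies its variant for REDUCED (instead of integral) `V` (the converse is trivial). [folklore] -/
theorem sand_with_isReduced_source (p : ℕ) (h : SandwichedStrongResolution.{u} p) :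
    ∀ (k : Type u) [Field k] [CharP k p] (U V : Scheme.{u}) (f : U ⟶ Spec (.of k)) (η : V ⟶ U),
      IsSeparated f → LocallyOfFiniteType f → QuasiCompact f → IsIntegral U →
      Scheme.IsRegular U → IsReduced V → IsProper η → IsBirational η →
        ∃ (Y : Scheme.{u}) (π : Y ⟶ V), IsResolution π ∧
          ∃ W : V.Opens, (W : Set V) = Scheme.regularLocus V ∧ IsIso (π ∣_ W) := by
  intro k _ _ U V f η hsep hft hqc hU hreg hV hη hbir
  haveI := hU
  haveI := hV
  exact h k U V f η hsep hft hqc hU hreg (isIntegral_source_of_isBirational η hbir) hη hbir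

end Summit.ResolutionOfSingularities.ResolutionOfSingularities.Theorems.PatchingRel.Negative
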